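import Summits.BirchSwinnertonDyer.BirchSwinnertonDyer.Theorems.CMKolyvaginAtInertTwoFullOrderPairCebotarevAtTwo
import HarnessLib

/-!
# Route `CMKolyvaginAtInertTwo`, crux `CMKolyvaginExactAtInertTwo` (stmt-BirchSwinnertonDyer-24277):
# the ORDER-`2` and MIXED Čebotarev sockets of the `plus_descent` engines on the CM-inert habitat

Seat `bsd-line-cmk2-p1` g16 (cell `bsd-print-cf2`); helper (`--supports stmt-BirchSwinnertonDyer-24277`).
THEOREMS ONLY: no definition, no named fact, no `sorry`; no item is closed; BSD is not proved by this.
Sequel of `…FullOrderPairCebotarevAtTwo` (`infinite_kolyvaginPrime_localization_fullOrder_pair_of_cmInert`,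
the CM-inert form of gk2's p693079). The lower-half engines of `GenusKolyvaginAtTwo` LINE 18 also call
the order-`2` sockets `…RTTwoClassChebotarev.infinite_kolyvaginPrime_localization_ne_zero_single` /
`_ne_zero_pair` (weak swap oracle, input I4) and `…RTMixedPairChebotarev.infinite_kolyvaginPrime_localization_mixed_pair`
(order `2` × order `2^κ`), all stated with `¬ W.HasCM`, `ρ_{E,2^∞} = GL₂(ℤ₂)` and a separation
hypothesis `hres`. They are special cases of the full-order pair; here they are on `H₂` (`W` globally
minimal with CM, `CMInert W 2`, `ρ̄_{W,2}` onto; `K` imaginary quadratic with the Heegner hypothesis),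
with the extra conjunct `CMInert W ℓ` and NO separation hypothesis:

* `infinite_kolyvaginPrime_localization_ne_zero_single_of_cmInert`,
* `infinite_kolyvaginPrime_localization_ne_zero_pair_of_cmInert`,
* `infinite_kolyvaginPrime_localization_mixed_pair_of_cmInert`.

References: [McCallumLMS1991] §3 Cor. 3.2; §5 proof of Prop. 5.2 ((11)–(12)); [GrossLMS1991] §9.
-/

-- single-conjunct summit: `Summit.BirchSwinnertonDyer.BirchSwinnertonDyer.…` repeats the name by design
set_option linter.dupNamespace false
set_option autoImplicit false

noncomputable section

open scoped Classical
open WeierstrassCurve NumberField IsDedekindDomain Field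
open Literature.NumberTheory.GaloisRepresentations Literature.NumberTheory.EllipticCurves
open Summit.BirchSwinnertonDyer.BirchSwinnertonDyer.Theorems.GenusExact.PlusDescent (addOrderOf_eq_two_pow_one)

namespace Summit.BirchSwinnertonDyer.BirchSwinnertonDyer.Theorems.KolyvaginImageTwo

section Sockets

variable (W : WeierstrassCurve ℚ) [W.IsElliptic] [W.IsGloballyMinimal] [NeZero (W.conductorNorm ℤ)]
  (K : Type) [Field K] [NumberField K]

omit [W.IsElliptic] [W.IsGloballyMinimal] [NeZero (W.conductorNorm ℤ)] in
/-- An eigenclass with `conjAct x = x` is an eigenclass of sign `1`. [folklore] -/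
private theorem conjAct_eq_one_zsmul {c : K ≃ₐ[ℚ] K} {M : ℕ} {x : galH1Torsion (W.baseChange K) ((2 ^ M : ℕ) : ℤ)}
    (h : conjAct W c ((2 ^ M : ℕ) : ℤ) x = x) : conjAct W c ((2 ^ M : ℕ) : ℤ) x = (1 : ℤ) • x := by
  rw [one_zsmul]; exact h

/-- **Socket `…RTTwoClassChebotarev.infinite_kolyvaginPrime_localization_ne_zero_single` on `H₂`**:
ONE non-zero class `x ∈ H¹(K, E[2^M])` killed by `2` and fixed by `c_*` is locally NON-ZERO at
infinitely many CM-inert Kolyvagin primes of depth `M` (Zhang index `≥ M`). No separation hypothesis.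
[cite: McCallumLMS1991, §3 Cor. 3.2] -/
theorem infinite_kolyvaginPrime_localization_ne_zero_single_of_cmInert (hCM : W.HasCM)
    (hin : Literature.NumberTheory.EllipticCurves.Rank1Residual.CMInert W 2)
    (hρ : W.HasSurjectiveModNGaloisRep 2) (hK : IsImaginaryQuadratic K)
    (hH : SatisfiesHeegnerHypothesis (W.conductorNorm ℤ) K) (c : K ≃ₐ[ℚ] K) (hc : c ≠ 1)
    (M : ℕ) (hM : 1 ≤ M) (x : galH1Torsion (W.baseChange K) ((2 ^ M : ℕ) : ℤ))
    (hx0 : x ≠ 0) (hx2 : 2 • x = 0) (hτx : conjAct W c ((2 ^ M : ℕ) : ℤ) x = x) :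
    Set.Infinite {ℓ : ℕ | FrobEqFrobInfty W K (2 ^ M) ℓ ∧
      Zhang2014.IsKolyvaginPrime (W.conductorNorm ℤ) W K 2 ℓ ∧ M ≤ Zhang2014.kolyvaginIndex W 2 ℓ ∧
      Literature.NumberTheory.EllipticCurves.Rank1Residual.CMInert W ℓ ∧
      ∀ v : HeightOneSpectrum (𝓞 K), (ℓ : 𝓞 K) ∈ v.asIdeal →
        x ∉ (W.baseChange K).torsionLocalKer (v.adicCompletion K) ((2 ^ M : ℕ) : ℤ)} := by
  have hx : addOrderOf x = 2 ^ 1 := addOrderOf_eq_two_pow_one hx2 hx0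
  have h := infinite_kolyvaginPrime_localization_fullOrder_pair_of_cmInert W K hCM hin hρ hK hH c hc M hM
    x x le_rfl le_rfl hx hx (Or.inl rfl) (Or.inl rfl) (conjAct_eq_one_zsmul W K hτx)
    (conjAct_eq_one_zsmul W K hτx)
  refine h.mono fun ℓ hℓ ↦ ⟨hℓ.1, hℓ.2.1, hℓ.2.2.1, hℓ.2.2.2.1, fun v hv hxv ↦ ?_⟩
  have h0 := (hℓ.2.2.2.2 v hv).1 0
  rw [pow_zero, Nat.cast_one, one_smul] at h0
  exact absurd (h0.mp hxv) (by omega)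

/-- **Socket `…RTTwoClassChebotarev.infinite_kolyvaginPrime_localization_ne_zero_pair` on `H₂`** (input
I4 of the weak swap oracle): TWO non-zero classes killed by `2` and fixed by `c_*` are BOTH locally
non-zero at infinitely many CM-inert Kolyvagin primes of depth `M`. No separation hypothesis.
[cite: McCallumLMS1991, §3 Cor. 3.2; §5 Prop. 5.2 (proof, (11)–(12))] -/
theorem infinite_kolyvaginPrime_localization_ne_zero_pair_of_cmInert (hCM : W.HasCM)
    (hin : Literature.NumberTheory.EllipticCurves.Rank1Residual.CMInert W 2)
    (hρ : W.HasSurjectiveModNGaloisRep 2) (hK : IsImaginaryQuadratic K)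
    (hH : SatisfiesHeegnerHypothesis (W.conductorNorm ℤ) K) (c : K ≃ₐ[ℚ] K) (hc : c ≠ 1)
    (M : ℕ) (hM : 1 ≤ M) (x y : galH1Torsion (W.baseChange K) ((2 ^ M : ℕ) : ℤ))
    (hx0 : x ≠ 0) (hy0 : y ≠ 0) (hx2 : 2 • x = 0) (hy2 : 2 • y = 0)
    (hτx : conjAct W c ((2 ^ M : ℕ) : ℤ) x = x) (hτy : conjAct W c ((2 ^ M : ℕ) : ℤ) y = y) :
    Set.Infinite {ℓ : ℕ | FrobEqFrobInfty W K (2 ^ M) ℓ ∧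
      Zhang2014.IsKolyvaginPrime (W.conductorNorm ℤ) W K 2 ℓ ∧ M ≤ Zhang2014.kolyvaginIndex W 2 ℓ ∧
      Literature.NumberTheory.EllipticCurves.Rank1Residual.CMInert W ℓ ∧
      ∀ v : HeightOneSpectrum (𝓞 K), (ℓ : 𝓞 K) ∈ v.asIdeal →
        x ∉ (W.baseChange K).torsionLocalKer (v.adicCompletion K) ((2 ^ M : ℕ) : ℤ) ∧
        y ∉ (W.baseChange K).torsionLocalKer (v.adicCompletion K) ((2 ^ M : ℕ) : ℤ)} := by
  have hx : addOrderOf x = 2 ^ 1 := addOrderOf_eq_two_pow_one hx2 hx0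
  have hy : addOrderOf y = 2 ^ 1 := addOrderOf_eq_two_pow_one hy2 hy0
  have h := infinite_kolyvaginPrime_localization_fullOrder_pair_of_cmInert W K hCM hin hρ hK hH c hc M hM
    x y le_rfl le_rfl hx hy (Or.inl rfl) (Or.inl rfl) (conjAct_eq_one_zsmul W K hτx)
    (conjAct_eq_one_zsmul W K hτy)
  refine h.mono fun ℓ hℓ ↦ ⟨hℓ.1, hℓ.2.1, hℓ.2.2.1, hℓ.2.2.2.1, fun v hv ↦ ⟨fun hxv ↦ ?_, fun hyv ↦ ?_⟩⟩
  · have h0 := (hℓ.2.2.2.2 v hv).1 0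
    rw [pow_zero, Nat.cast_one, one_smul] at h0
    exact absurd (h0.mp hxv) (by omega)
  · have h0 := (hℓ.2.2.2.2 v hv).2 0
    rw [pow_zero, Nat.cast_one, one_smul] at h0
    exact absurd (h0.mp hyv) (by omega)

/-- **Socket `…RTMixedPairChebotarev.infinite_kolyvaginPrime_localization_mixed_pair` on `H₂`**: a
non-zero class `x` killed by `2` and a class `y` of order `2^κ` (`κ ≥ 1`), both fixed by `c_*`, get
`x_λ ≠ 0` and `ord y_λ = 2^κ` at infinitely many CM-inert Kolyvagin primes of depth `M`. No separation
hypothesis. [cite: McCallumLMS1991, §3 Cor. 3.2; §5 Prop. 5.2 (proof, (11)–(12))] -/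
theorem infinite_kolyvaginPrime_localization_mixed_pair_of_cmInert (hCM : W.HasCM)
    (hin : Literature.NumberTheory.EllipticCurves.Rank1Residual.CMInert W 2)
    (hρ : W.HasSurjectiveModNGaloisRep 2) (hK : IsImaginaryQuadratic K)
    (hH : SatisfiesHeegnerHypothesis (W.conductorNorm ℤ) K) (c : K ≃ₐ[ℚ] K) (hc : c ≠ 1)
    (M : ℕ) (hM : 1 ≤ M) (x y : galH1Torsion (W.baseChange K) ((2 ^ M : ℕ) : ℤ))
    (hx0 : x ≠ 0) (hx2 : 2 • x = 0) {κ : ℕ} (hκ : 1 ≤ κ) (hy : addOrderOf y = 2 ^ κ)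
    (hτx : conjAct W c ((2 ^ M : ℕ) : ℤ) x = x) (hτy : conjAct W c ((2 ^ M : ℕ) : ℤ) y = y) :
    Set.Infinite {ℓ : ℕ | FrobEqFrobInfty W K (2 ^ M) ℓ ∧
      Zhang2014.IsKolyvaginPrime (W.conductorNorm ℤ) W K 2 ℓ ∧ M ≤ Zhang2014.kolyvaginIndex W 2 ℓ ∧
      Literature.NumberTheory.EllipticCurves.Rank1Residual.CMInert W ℓ ∧
      ∀ v : HeightOneSpectrum (𝓞 K), (ℓ : 𝓞 K) ∈ v.asIdeal →
        x ∉ (W.baseChange K).torsionLocalKer (v.adicCompletion K) ((2 ^ M : ℕ) : ℤ) ∧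
        ∀ j : ℕ, ((2 ^ j : ℕ) : ℤ) • y ∈
            (W.baseChange K).torsionLocalKer (v.adicCompletion K) ((2 ^ M : ℕ) : ℤ) ↔ κ ≤ j} := by
  have hx : addOrderOf x = 2 ^ 1 := addOrderOf_eq_two_pow_one hx2 hx0
  have h := infinite_kolyvaginPrime_localization_fullOrder_pair_of_cmInert W K hCM hin hρ hK hH c hc M hM
    x y le_rfl hκ hx hy (Or.inl rfl) (Or.inl rfl) (conjAct_eq_one_zsmul W K hτx)
    (conjAct_eq_one_zsmul W K hτy)
  refine h.mono fun ℓ hℓ ↦ ⟨hℓ.1, hℓ.2.1, hℓ.2.2.1, hℓ.2.2.2.1, fun v hv ↦ ⟨fun hxv ↦ ?_, (hℓ.2.2.2.2 v hv).2⟩⟩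
  have h0 := (hℓ.2.2.2.2 v hv).1 0
  rw [pow_zero, Nat.cast_one, one_smul] at h0
  exact absurd (h0.mp hxv) (by omega)

end Sockets

/-! ## Appendix (same seat): NO PHANTOM CLASSES on `H₂` — the separation hypothesis `hres` of the
`GenusKolyvaginAtTwo` Čebotarev sockets holds for EVERY class

The non-CM engines display Q5R's separation hypothesis `hres` («the span of the classes meets the
inflation kernel `H¹(K(E[2^M])/K, E[2^M])` trivially»); for full `2`-adic image that kernel is
non-zero at level `4` (Lawson–Wuthrich: `H¹(GL₂(ℤ/4), (ℤ/4)²) = ℤ/2`, gk2 LEAD g16's finding (B), an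
OPEN input of their bottom-rung engine). On the CM-inert habitat the kernel VANISHES at every level:
Gross's Prop. 9.1 at `2` (`h1_restriction_injective_two_pow`, g7) under the Cartan element of order `3`
(`exists_smul_three_of_hasSurjectiveModNGaloisRep`) and ty2's `CartanAtTwo.hcomm_of_habitat`. -/

section NoPhantom

variable (W : WeierstrassCurve ℚ) [W.IsElliptic] (K : Type) [Field K] [NumberField K]

/-- **`H¹(K(E[2^M])/K, E[2^M]) = 0` on `H₂` (every level `M`): a class of `H¹(K, E[2^M])` whose
evaluations at `Γ_{K(E[2^M])}` all vanish is `0`** — for `W/ℚ` with CM, `CMInert W 2`, `ρ̄_{W,2}`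
onto and ANY imaginary quadratic `K`. Hence Q5R's separation hypothesis `hres` of the
`GenusKolyvaginAtTwo` sockets (`…_ne_zero_single/_pair`, `…_mixed_pair`, `…_fullOrder_pair`) holds for
every family on `H₂`: there are no Lawson–Wuthrich phantom classes on the CM-inert habitat.
[cite: GrossLMS1991, §9 Prop. 9.1] [cite: McCallumLMS1991, §3 (2)] [cite: LawsonWuthrich2016, Lemma 6] -/
theorem h1_restriction_injective_two_pow_of_cmInert (hCM : W.HasCM)
    (hin : Literature.NumberTheory.EllipticCurves.Rank1Residual.CMInert W 2)
    (hρ : W.HasSurjectiveModNGaloisRep 2) (hK : IsImaginaryQuadratic K) {M : ℕ}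
    {x : galH1Torsion (W.baseChange K) ((2 ^ M : ℕ) : ℤ)}
    (hx : ∀ ρ ∈ torsionFixing (W.baseChange K) ((2 ^ M : ℕ) : ℤ),
      h1Eval (W.baseChange K) ((2 ^ M : ℕ) : ℤ) x ρ = 0) : x = 0 := by
  obtain ⟨z, -, hzfix⟩ := exists_smul_three_of_hasSurjectiveModNGaloisRep W K hK.1 hρ
  exact h1_restriction_injective_two_pow W K hzfix
    (Summit.BirchSwinnertonDyer.Rank1Residual.P2.CartanAtTwo.hcomm_of_habitat W K hCM hin hρ hzfix) hx

/-- **Q5R's separation hypothesis `hres` for a PAIR, on `H₂`** (the shape displayed by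
`PlusDescent.infinite_kolyvaginPrime_localization_fullOrder_pair` / `_ne_zero_pair` / `_mixed_pair`):
`∀ a b, (∀ ρ ∈ Γ_{K(E[2^M])}, [a•x + b•y, ρ] = 0) → a•x + b•y = 0`. [cite: GrossLMS1991, §9 Prop. 9.1]
[cite: McCallumLMS1991, §3 (2), Cor. 3.2] -/
theorem hres_pair_of_cmInert (hCM : W.HasCM)
    (hin : Literature.NumberTheory.EllipticCurves.Rank1Residual.CMInert W 2)
    (hρ : W.HasSurjectiveModNGaloisRep 2) (hK : IsImaginaryQuadratic K) {M : ℕ}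
    (x y : galH1Torsion (W.baseChange K) ((2 ^ M : ℕ) : ℤ)) :
    ∀ a b : ℤ, (∀ ρ ∈ torsionFixing (W.baseChange K) ((2 ^ M : ℕ) : ℤ),
      h1Eval (W.baseChange K) ((2 ^ M : ℕ) : ℤ) (a • x + b • y) ρ = 0) → a • x + b • y = 0 :=
  fun _ _ h ↦ h1_restriction_injective_two_pow_of_cmInert W K hCM hin hρ hK h

end NoPhantom

end Summit.BirchSwinnertonDyer.BirchSwinnertonDyer.Theorems.KolyvaginImageTwo

end
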